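import Mathlib
import HarnessLib
import Summits.HubbardSuperconductivity.HubbardSuperconductivity.Theorems.KLProgrammeKLRegimeEngineTowerWtProfileBase
import Summits.HubbardSuperconductivity.HubbardSuperconductivity.Theorems.KLProgrammeKLRegimeEngineTowerWtZUnitOfKitGuard

/-!
# Route `KLProgramme` — crux K3 ENGINE (stmt-HubbardSuperconductivity-20437 `KLRegimeEngineV17F2`), stub (b) v2, THE WEIGHTED HALF «(b)-WT4»:
# W5 — THE ONE-TRACK WEIGHTED TOWER LAW ON THE FLOW FRAME `K_n` WITH THE LINK, THE Z-THREAD AND THE BRIDGE DISCHARGED, base datum as ROWS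
# (cell gate-hubbard-kl, seat hubbard-kl-k3c3-p2 g17; weighted twin of p4's `klTowerBLevF_le_law_lev_of_blocks_ZX_klEng` in the «_rows» keying p3 g22 proposed
#  for (ℓ) (KL STATUS l.11230); composes W3b `klTowerBornWtAt_le_law_of_base_rows_klEng_tokX`, W2 `wtLaw_hstep_of_blockBounds`, W4 `wtLaw_hZsucc_of_blockBounds`
#  over ONE bundle of per-block data W2b `linkDataW_klEng`; E1 may rename or supersede)

WHAT IS DISCHARGED HERE.  On `K := klFlowFrameU … n`, for block length `d ≥ 2`, block count `Kb ≥ 1` and read-out rate `j` with `d·Kb ≤ j ≤ n`: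
(i) the weighted STEP at every block `1 ≤ k < Kb` (Gram constant of the fat-sandwiched slice, p3; rate-`j` weighted decay and analysis-overlap rows, this
lineage's g12 packages — through W2's k-free LINK), (ii) the Z-THREAD (`Z^{K_n}_{Λ_{dk}} ≠ 0` propagated from the base block by the law's own kit guard, W4),
(iii) the re-measurement BRIDGE at every block `2 ≤ k ≤ Kb` (p4 g17's m-uniform weighted jump row, W3a/W3b), (iv) the block-`1` profile (from the base rows).
WHAT STAYS A ROW (by class): the BASE DATUM of `𝒱_d` at `(F_{d−1}, rate j)` — `N_b ≥ 0`, `hcar`, and its unit law `(A_b, Q_b)` — [p3: the weighted twin of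
`baseLawF_blockZeroF_klEng`, level-0 datum + thick block-0 step; the grid rows at `(Λ_d, F_{d−1})` are in p4 g21's located class]; `Z^{K_n}_{Λ_d} ≠ 0` [with the
base datum]; the three weighted IMPORTS `ι₁ʷ ι₂ʷ ι₃ʷ` at every block `1 ≤ k ≤ Kb` [E1 weighted plain lines `S₂ʷ S₄ʷ S₆ʷ` via k3c2-p3's …TowerImportWtArrays]; the
kit's NUMERICS at the explicit `(W, Z, σ, τ, ψ, Φ)` and `A′ ≥ W·max(A_R, A_b)`, `Q″ ≥ Z·max(Q_R, Q_b)` [p4 «part 4»]; the caps `card/2 ≤ D`.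
* §1 `klTowerMeasWtAt_le_of_rows` — a block's measured array against a bound of its pinned sums at a propositionally equal family index (used at `k = 1`,
  `d·1 − 1 = d − 1`);
* §2 **`klTowerBornWtAt_le_law_of_blocks_klEng_tokX (d R c″)`** — `∃ C₁ C₂ Cκ Cb CJ > 0`, `R.WF2 → ∃ c₃′ U₀′ > 0` such that under the binders above:
  `(∀ k, 1 ≤ k ≤ Kb → Z^{K_n}_{Λ_{dk}} ≠ 0) ∧ (∀ k, 2 ≤ k ≤ Kb, ∀ 3 ≤ p ≤ D, klTowerBornWtAt … d (k−1) j (2p)/klLevUnitF β M 0 p (d(k−1)) ≤ Aλ^{p−1}Q′^p) ∧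
  (∀ k, 1 ≤ k ≤ Kb, ∀ 4 ≤ m ≤ D, W·Z^m·klTowerMeasWtAt … d k j (2m)/klLevUnitF β M 0 m (dk−1) ≤ A′λ^{m−1}Q″^m)`.
Compositions of landed theorems and elementary arithmetic; nothing about the model is asserted beyond them; nothing asserts (b), (ℓ), any stub, K3 or superconductivity.
References: BGM 2006 §2.3 (2.13)–(2.14), §2.8 (2.76)–(2.84), (2.93)–(2.98), §3 (3.2)–(3.8) [cite: BenfattoGiulianiMastropietro2006].
-/

noncomputable section

namespace Summit.HubbardSuperconductivity.HubbardSuperconductivity.Theorems.EngineV8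

set_option linter.dupNamespace false -- summit = problem name (single-conjunct summit), D-0017

open Classical
open Real Finset Literature.MathematicalPhysics.QuantumLattice Literature.Probability.LatticeModels GrassmannAlgebra
open Literature.MathematicalPhysics.QuantumLattice.FermiRG Literature.MathematicalPhysics.QuantumLattice.FermiRG.BGM2006Routing
open Summit.HubbardSuperconductivity.HubbardSuperconductivity.Theorems.KLProgrammeLegKernels
open Summit.HubbardSuperconductivity.HubbardSuperconductivity.Theorems.KLRegimeSplit
open Summit.HubbardSuperconductivity.HubbardSuperconductivity.Theorems.KLRegimeWick
open Summit.HubbardSuperconductivity.HubbardSuperconductivity.Theorems.TwoPointAssembly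
open Summit.HubbardSuperconductivity.HubbardSuperconductivity.Theorems.DispersionFlow
open Summit.HubbardSuperconductivity.HubbardSuperconductivity.Theorems.TorusFourierL2

variable {L M : ℕ} [NeZero L] [NeZero M]

/-! ## §1 A block's measured array against rows at a propositionally equal family index -/

omit [NeZero M] in
/-- **The measured weighted array of block `k` is at most any common bound of its rate-`j` pinned sums**, the family index given as `J = dk − 1`
(so that rows stated at `F_{d−1}` serve the block `k = 1`). -/
theorem klTowerMeasWtAt_le_of_rows (β U μ : ℝ) (K : TrigPolyC4v) (d k j m : ℕ) {J : ℕ} (hJ : d * k - 1 = J) {N : ℝ} (hN : 0 ≤ N)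
    (h : ∀ (q : Fin m) (w : SpaceTimeIdx L M × SectorLeg (sectorCount J)), klWtPinnedSumAt L M β μ K J j m (klTowerInput L M β U μ K d k) q w ≤ N) :
    klTowerMeasWtAt L M β U μ K d k j m ≤ N := by
  subst hJ
  unfold klTowerMeasWtAt
  rcases isEmpty_or_nonempty (Fin m × (SpaceTimeIdx L M × SectorLeg (sectorCount (d * k - 1)))) with he | he
  · rw [Real.iSup_of_isEmpty]; exact hN
  · exact ciSup_le fun qw => h qw.1 qw.2

/-! ## §2 The weighted law on the flow frame: LINK, Z-thread and bridge discharged -/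

/-- **THE ONE-TRACK WEIGHTED TOWER LAW ON `K_n` — LINK, Z-THREAD, BRIDGE AND BLOCK-1 PROFILE DISCHARGED; BASE DATUM, IMPORTS AND NUMERICS AS ROWS.**
See the module docstring for the binder list; the k-free bounds `κ̄ ᾱ c̄r c̄c` are ANY dominants of the LINK's constants (`√(2Cκe₀) ≤ κ̄`, `Cb(M/β)4^d/e₀ ≤ ᾱ`, `81CJM/β ≤ c̄r`, `162CJM/β ≤ c̄c` — so that a read-out step may share them), the names `W Z σ τ ψ Φ` are pinned by equations (instantiate with `rfl`), the profile constants by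
the four dominations `W·A_R ≤ A′`, `Z·Q_R ≤ Q″`, `W·A_b ≤ A′`, `Z·Q_b ≤ Q″` (`A_R = (C₁/C₂)8^{d−1}(A_b + A/(1−(2^d)⁻¹))`, `Q_R = C₂²(2^{d−1})⁻¹·max Q′ Q_b`).
[cite: BenfattoGiulianiMastropietro2006, §2.3 (2.13)-(2.14), §2.8 (2.76)-(2.84), (2.93)-(2.98), §3 (3.2)-(3.8)] -/
theorem klTowerBornWtAt_le_law_of_blocks_klEng_tokX (d : ℕ) (R : RenConsts) (c'' : ℝ) (hc'' : 0 < c'') :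
    ∃ C₁ C₂ Cκ Cb CJ : ℝ, 0 < C₁ ∧ 0 < C₂ ∧ 0 < Cκ ∧ 0 < Cb ∧ 0 < CJ ∧ (R.WF2 → ∃ c₃' : ℝ, 0 < c₃' ∧ ∃ U₀' : ℝ, 0 < U₀' ∧
      ∀ (G : GeoConsts) (P : SplitConsts) (Q : EngConsts) (c : ℝ), P.WF → 0 < c → c ≤ klEngC₃6 P R → c ≤ c₃' →
      ∀ μ ∈ klWindowC, ∀ U : ℝ, 0 < U → U ≤ klEngU₀9 P R c → U ≤ U₀' → c'' * U ≤ 1 →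
      ∀ β : ℝ, klBetaMin ≤ β → β ≤ Real.exp (c / U ^ 2) →
      ∀ (L M : ℕ) [NeZero L] [NeZero M], klEngL₃ β U ≤ L → klEngM₃ β U L ≤ M →
      ∀ n : ℕ, 1 ≤ n → n ≤ nScales β + 1 → IsKLRegime U c (-(n : ℤ)) → HistP klPredsV17F2 L M G P Q R β U μ 0 n →
        (∀ m', 1 ≤ m' → m' < n → FlowPieceOscAt L M c'' β U μ m') →
      2 ≤ d → ∀ Kb j : ℕ, 1 ≤ Kb → d * Kb ≤ j → j ≤ n →
      ∀ D : ℕ, 3 ≤ D → (∀ k, 1 ≤ k → k ≤ Kb → Fintype.card (SpaceTimeIdx L M × SectorLeg (sectorCount (d * k - 1))) / 2 ≤ D) →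
      ∀ (A lam Q' Ab Qb : ℝ), 0 ≤ A → 0 < lam → 0 < Q' → 0 ≤ Ab → 0 ≤ Qb →
      -- the base datum of `𝒱_d` at `(F_{d−1}, rate j)` and its unit law [p3 class]
      ∀ Nb : ℕ → ℝ, (∀ p, 0 ≤ Nb p) →
        (∀ (p : ℕ) (q : Fin (2 * p)) (w' : SpaceTimeIdx L M × SectorLeg (sectorCount (d - 1))),
          klWtPinnedSumAt L M β μ (klFlowFrameU L M β U μ n) (d - 1) j (2 * p) (klTowerInput L M β U μ (klFlowFrameU L M β U μ n) d 1) q w' ≤ Nb p) →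
        (∀ p : ℕ, 3 ≤ p → Nb p / klLevUnitF β M 0 p (d - 1) ≤ Ab * lam ^ (p - 1) * Qb ^ p) →
      hubbardEffPartitionFnCT L M β U μ 0 (klFlowFrameU L M β U μ n) (klScale klE0 d) ≠ 0 →
      -- the names
      -- the k-free bounds: ANY dominants of the LINK's constants (so that a read-out step may share them)
      ∀ (κb αb crb ccb : ℝ), Real.sqrt (2 * Cκ * klE0) ≤ κb → Cb * ((M : ℝ) / β) * (4 : ℝ) ^ d / klE0 ≤ αb →
        81 * CJ * M / β ≤ crb → 162 * CJ * M / β ≤ ccb →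
      ∀ (W Z σ τ ψ Φ : ℝ),
        W = 32 * crb / ccb → Z = imagTimeWeight β M ^ 2 * ccb ^ 2 / 8 →
        σ = κb ^ 2 / ccb ^ 2 → τ = 4 * exp 4 * κb ^ 2 / ccb ^ 2 → ψ = ccb ^ 2 / κb ^ 2 → Φ = exp 1 * αb * ccb / (κb ^ 2 * crb) →
      ∀ (A' Q'' : ℝ),
        W * ((C₁ / C₂) * (8 : ℝ) ^ (d - 1) * (Ab + A / (1 - ((2 : ℝ) ^ d)⁻¹))) ≤ A' →
        Z * (C₂ ^ 2 * ((2 : ℝ) ^ (d - 1))⁻¹ * max Q' Qb) ≤ Q'' → W * Ab ≤ A' → Z * Qb ≤ Q'' → 0 < Q'' →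
      -- the weighted imports (degrees 2, 4, 6) at every block 1 ≤ k ≤ Kb [E1 class]
      ∀ (ι₁ ι₂ ι₃ : ℝ),
      (∀ k, 1 ≤ k → k ≤ Kb → W * Z ^ 1 *
        (klTowerMeasWtAt L M β U μ (klFlowFrameU L M β U μ n) d k j (2 * 1) / klLevUnitF β M 0 1 (d * k - 1)) ≤ ι₁ * lam) →
      (∀ k, 1 ≤ k → k ≤ Kb → W * Z ^ 2 *
        (klTowerMeasWtAt L M β U μ (klFlowFrameU L M β U μ n) d k j (2 * 2) / klLevUnitF β M 0 2 (d * k - 1)) ≤ ι₂ * lam) →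
      (∀ k, 1 ≤ k → k ≤ Kb → W * Z ^ 3 *
        (klTowerMeasWtAt L M β U μ (klFlowFrameU L M β U μ n) d k j (2 * 3) / klLevUnitF β M 0 3 (d * k - 1)) ≤ ι₃ * lam ^ 2) →
      -- the kit's numerics [p4 class]
      4 * σ * lam * Q'' < 1 → 2 * lam * τ * Q'' ≤ 1 → exp 1 * τ * lam * Q'' < 1 →
      Φ * (τ * (ι₁ * lam + ι₂ / (2 * Q'') + ι₃ / (4 * Q'' ^ 2) + A' * Q'' / 4)) < 1 →
      Φ * (exp 1 * τ * (ι₁ * lam) + (exp 1 * τ) ^ 2 * (ι₂ * lam) + (exp 1 * τ) ^ 3 * (ι₃ * lam ^ 2) +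
        A' * (exp 1 * τ * Q'') * ((exp 1 * τ * lam * Q'') ^ 3 / (1 - exp 1 * τ * lam * Q''))) < 1 →
      4 * Q'' ≤ Q' → 2 * τ * ψ * Q'' ≤ Q' →
      A' * (4 * Q'') ^ 3 * (4 * σ * lam * Q'' / (1 - 4 * σ * lam * Q'')) +
        exp 1 * ψ * (2 * τ * ψ * Q'') ^ 2 * (τ * (ι₁ * lam + ι₂ / (2 * Q'') + ι₃ / (4 * Q'' ^ 2) + A' * Q'' / 4)) *
          (Φ * (τ * (ι₁ * lam + ι₂ / (2 * Q'') + ι₃ / (4 * Q'' ^ 2) + A' * Q'' / 4)) /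
            (1 - Φ * (τ * (ι₁ * lam + ι₂ / (2 * Q'') + ι₃ / (4 * Q'' ^ 2) + A' * Q'' / 4)))) ≤ A * Q' ^ 3 →
      (∀ k, 1 ≤ k → k ≤ Kb → hubbardEffPartitionFnCT L M β U μ 0 (klFlowFrameU L M β U μ n) (klScale klE0 (d * k)) ≠ 0) ∧
      (∀ k, 2 ≤ k → k ≤ Kb → ∀ p : ℕ, 3 ≤ p → p ≤ D →
        klTowerBornWtAt L M β U μ (klFlowFrameU L M β U μ n) d (k - 1) j (2 * p) / klLevUnitF β M 0 p (d * (k - 1)) ≤ A * lam ^ (p - 1) * Q' ^ p) ∧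
      (∀ k, 1 ≤ k → k ≤ Kb → ∀ m, 4 ≤ m → m ≤ D → W * Z ^ m *
        (klTowerMeasWtAt L M β U μ (klFlowFrameU L M β U μ n) d k j (2 * m) / klLevUnitF β M 0 m (d * k - 1)) ≤ A' * lam ^ (m - 1) * Q'' ^ m)) := by
  obtain ⟨C₁, C₂, hC₁, hC₂, hbr⟩ := klTowerBornWtAt_le_law_of_base_rows_klEng_tokX R c'' hc''
  obtain ⟨Cκ, Cb, CJ, hCκ, hCb, hCJ, hlink⟩ := linkDataW_klEng d R c'' hc''
  refine ⟨C₁, C₂, Cκ, Cb, CJ, hC₁, hC₂, hCκ, hCb, hCJ, fun hR2 => ?_⟩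
  obtain ⟨c₃, hc₃, U₀, hU₀, hbr'⟩ := hbr hR2
  refine ⟨c₃, hc₃, U₀, hU₀, ?_⟩
  intro G P Q c hP hc hc6 hc₃' μ hμ U hU hU9 hU₀' hcU β hβmin hβc L M _ _ hL3 hM3 n hn1 hnN hkl hhist hosc hd Kb j hKb1 hKbj hjn D hD3 hD
    A lam Q' Ab Qb hA hlam hQ hAb hQb Nb hNb0 hcar hlawb hZd κb αb crb ccb hκb hαb hcrb hccb W Z σ τ ψ Φ hW hZ' hσ hτ hψ hΦ
    A' Q'' hA'1 hQ'1 hA'2 hQ'2 hQ'0 ι₁ ι₂ ι₃ hι₁ hι₂ hι₃ hx₁ hx₂ hx₃ hy hθ hu₁ hu₂ hclose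
  have he : (0 : ℝ) < klE0 := by norm_num [klE0]
  have hβ : 0 < β := KLRegimeSplit.pos_of_klBetaMin_le hβmin
  have hM0 : (0 : ℝ) < M := Nat.cast_pos.2 (Nat.pos_of_ne_zero (NeZero.ne M))
  have hx : 0 < imagTimeWeight β M := imagTimeWeight_pos_of_pos (M := M) hβ
  have hfr : FrameOK R U (nScales β) μ (klFlowFrameU L M β U μ n) := frameOK_klFlowFrameU_of_histP_le hR2 hn1 le_rfl hnN hhist
  set K : TrigPolyC4v := klFlowFrameU L M β U μ n with hKdef
  -- the four k-free constants are positive; so are the six names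
  have hsq0 : 0 < Real.sqrt (2 * Cκ * klE0) := Real.sqrt_pos.2 (by positivity)
  have hκb0 : 0 < κb := lt_of_lt_of_le hsq0 hκb
  have hαb0 : 0 < αb := lt_of_lt_of_le (by positivity) hαb
  have hcrb0 : 0 < crb := lt_of_lt_of_le (by positivity) hcrb
  have hccb0 : 0 < ccb := lt_of_lt_of_le (by positivity) hccb
  have hκbsq : Real.sqrt (2 * Cκ * klE0) ^ 2 ≤ κb ^ 2 := pow_le_pow_left₀ hsq0.le hκb 2
  have hW0 : 0 < W := by rw [hW]; positivity
  have hZ0 : 0 < Z := by rw [hZ']; positivity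
  have hσ0 : 0 ≤ σ := by rw [hσ]; positivity
  have hτ0 : 0 < τ := by rw [hτ]; positivity
  have hψ0 : 0 ≤ ψ := by rw [hψ]; positivity
  have hΦ0 : 0 ≤ Φ := by rw [hΦ]; positivity
  -- block ranges
  have hblk : ∀ k, 1 ≤ k → k < Kb → 2 ≤ d * k ∧ d * (k + 1) ≤ nScales β + 1 ∧ d * k ≤ n ∧ d * k ≤ j := by
    intro k hk1 hk
    have h1 : d * (k + 1) ≤ d * Kb := Nat.mul_le_mul_left d (by omega)
    have h2 : d * k + d = d * (k + 1) := (Nat.mul_succ d k).symm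
    refine ⟨le_trans hd (Nat.le_mul_of_pos_right d hk1), by omega, by omega, by omega⟩
  -- the per-block data, ONE bundle for the step and the Z-thread
  set κf : ℕ → ℝ := fun k => Real.sqrt (Cκ * (klScale klE0 (d * k) / klScale klE0 (d * k - 1)) * (klE0 * ((8 : ℝ) ^ (d * k - 1))⁻¹)) with hκf
  set αf : ℕ → ℝ := fun k => Cb * ((M : ℝ) / β) / klScale klE0 (d * (k + 1)) with hαf
  have hdata : ∀ k, 1 ≤ k → k < Kb →
      0 < κf k ∧ κf k ^ 2 * (8 : ℝ) ^ (d * k) ≤ κb ^ 2 ∧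
      IsGramBoundedR ((sectorSubMatrix L M β (bgmFatMultiplier L M klE0 β (nambuXiCT L μ K) (d * k - 1))).transpose *
        hubbardCovSliceCT L M β μ 0 K (klScale klE0 (d * (k + 1))) (klScale klE0 (d * k)) *
          sectorSubMatrix L M β (bgmFatMultiplier L M klE0 β (nambuXiCT L μ K) (d * k - 1))) (κf k) ∧
      (∀ X, ∑ Y, ‖((sectorSubMatrix L M β (bgmFatMultiplier L M klE0 β (nambuXiCT L μ K) (d * k - 1))).transpose *
        hubbardCovSliceCT L M β μ 0 K (klScale klE0 (d * (k + 1))) (klScale klE0 (d * k)) *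
          sectorSubMatrix L M β (bgmFatMultiplier L M klE0 β (nambuXiCT L μ K) (d * k - 1))) X Y‖ *
        klScaleWt L M β j {latticeLegPos (2 * (2 * M)) X, latticeLegPos (2 * (2 * M)) Y} ≤ αf k) ∧
      (∀ Y, ∑ X, ‖((sectorSubMatrix L M β (bgmFatMultiplier L M klE0 β (nambuXiCT L μ K) (d * k - 1))).transpose *
        hubbardCovSliceCT L M β μ 0 K (klScale klE0 (d * (k + 1))) (klScale klE0 (d * k)) *
          sectorSubMatrix L M β (bgmFatMultiplier L M klE0 β (nambuXiCT L μ K) (d * k - 1))) X Y‖ *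
        klScaleWt L M β j {latticeLegPos (2 * (2 * M)) X, latticeLegPos (2 * (2 * M)) Y} ≤ αf k) ∧
      αf k ≤ αb * (4 : ℝ) ^ (d * k) ∧
      (∀ X'', ∑ X', ‖(sectorAnalysisMatrix L M β (klAnisoFamily L M β μ K klE0 (d * k)) *
        sectorSubMatrix L M β (bgmFatMultiplier L M klE0 β (nambuXiCT L μ K) (d * k - 1))) X'' X'‖ *
        klScaleWt L M β j {latticeLegPos (2 * (2 * M)) X'', latticeLegPos (2 * (2 * M)) X'} ≤ crb) ∧
      (∀ X', ∑ X'', ‖(sectorAnalysisMatrix L M β (klAnisoFamily L M β μ K klE0 (d * k)) *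
        sectorSubMatrix L M β (bgmFatMultiplier L M klE0 β (nambuXiCT L μ K) (d * k - 1))) X'' X'‖ *
        klScaleWt L M β j {latticeLegPos (2 * (2 * M)) X'', latticeLegPos (2 * (2 * M)) X'} ≤ ccb) := by
    intro k hk1 hk
    obtain ⟨hdk, hkN, hkn, hkj⟩ := hblk k hk1 hk
    obtain ⟨h1, h2, h3, h4, h5, h6, h7, h8⟩ := hlink G P Q c hP hR2 hc hc6 μ hμ U hU hU9 hcU β hβmin hβc L M hL3 hM3 n hn1 hnN hkl hhist hfr hosc
      k hk1 hdk hkN hkn j hkj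
    refine ⟨h1, h2.trans hκbsq, h3, h4, h5, h6.trans (mul_le_mul_of_nonneg_right hαb (by positivity)), fun X'' => (h7 X'').trans hcrb,
      fun X' => (h8 X').trans hccb⟩
  -- the step (W2) and the Z-thread (W4) from the bundle
  have hstep := wtLaw_hstep_of_blockBounds (L := L) (M := M) hβ U μ K (by omega : 1 ≤ d) j Kb hκb0 hαb0 hcrb0 hccb0 κf αf
    (fun k hk1 hk => (hdata k hk1 hk).1) (fun k hk1 hk => (hdata k hk1 hk).2.1) (fun k hk1 hk => (hdata k hk1 hk).2.2.2.2.2.1)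
    (fun k hk1 hk => (hdata k hk1 hk).2.2.1) (fun k hk1 hk => (hdata k hk1 hk).2.2.2.1) (fun k hk1 hk => (hdata k hk1 hk).2.2.2.2.1)
    (fun k hk1 hk => (hdata k hk1 hk).2.2.2.2.2.2.1) (fun k hk1 hk => (hdata k hk1 hk).2.2.2.2.2.2.2) (fun k hk1 hk => hD k hk1 hk.le)
    W Z σ τ ψ Φ hW hZ' hσ hτ hψ hΦ
  have hZsucc := wtLaw_hZsucc_of_blockBounds (L := L) (M := M) hβ U μ K (by omega : 1 ≤ d) j Kb hκb0 hαb0 hcrb0 hccb0 κf αf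
    (fun k hk1 hk => (hdata k hk1 hk).1) (fun k hk1 hk => (hdata k hk1 hk).2.1) (fun k hk1 hk => (hdata k hk1 hk).2.2.2.2.2.1)
    (fun k hk1 hk => (hdata k hk1 hk).2.2.1) (fun k hk1 hk => (hdata k hk1 hk).2.2.2.1) (fun k hk1 hk => (hdata k hk1 hk).2.2.2.2.1)
    (fun k hk1 hk => hD k hk1 hk.le) W Z τ Φ hW hZ' hτ hΦ
  -- the block-1 profile from the base rows
  have hZ1 : hubbardEffPartitionFnCT L M β U μ 0 K (klScale klE0 (d * 1)) ≠ 0 := by rw [Nat.mul_one]; exact hZd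
  have hbase : ∀ m, 4 ≤ m → m ≤ D →
      W * Z ^ m * (klTowerMeasWtAt L M β U μ K d 1 j (2 * m) / klLevUnitF β M 0 m (d * 1 - 1)) ≤ A' * lam ^ (m - 1) * Q'' ^ m := by
    intro m hm hmD
    have hu0 : 0 < klLevUnitF β M 0 m (d - 1) := klLevUnitF_pos hβ 0 m _
    have hmeas : klTowerMeasWtAt L M β U μ K d 1 j (2 * m) ≤ Nb m :=
      klTowerMeasWtAt_le_of_rows β U μ K d 1 j (2 * m) (by omega : d * 1 - 1 = d - 1) (hNb0 m) (hcar m)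
    have h1 : klTowerMeasWtAt L M β U μ K d 1 j (2 * m) / klLevUnitF β M 0 m (d * 1 - 1) ≤ Ab * lam ^ (m - 1) * Qb ^ m := by
      rw [show d * 1 - 1 = d - 1 by omega]
      exact (div_le_div_of_nonneg_right hmeas hu0.le).trans (hlawb m (by omega))
    have hWZ : 0 ≤ W * Z ^ m := by positivity
    calc W * Z ^ m * (klTowerMeasWtAt L M β U μ K d 1 j (2 * m) / klLevUnitF β M 0 m (d * 1 - 1))
        ≤ W * Z ^ m * (Ab * lam ^ (m - 1) * Qb ^ m) := mul_le_mul_of_nonneg_left h1 hWZ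
      _ = (W * Ab) * lam ^ (m - 1) * (Z * Qb) ^ m := by rw [mul_pow]; ring
      _ ≤ A' * lam ^ (m - 1) * Q'' ^ m := by
          have hA'0 : 0 ≤ A' := le_trans (by positivity) hA'2
          exact mul_le_mul (mul_le_mul_of_nonneg_right hA'2 (pow_nonneg hlam.le _)) (pow_le_pow_left₀ (by positivity) hQ'2 m)
            (pow_nonneg (by positivity) _) (by positivity)
  -- W3b
  exact hbr' G P Q c hc hc6 hc₃' μ hμ U hU hU9 hU₀' hcU β hβmin hβc L M hL3 hM3 n hn1 hnN hkl hhist hosc d Kb D hd (by omega) hD3 j (by omega)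
    A lam Q' Ab Qb hA hlam hQ hAb hQb Nb hNb0 hcar hlawb W Z A' Q'' hW0 hZ0 hA'1 hQ'1 hQ'0 σ Φ ψ τ ι₁ ι₂ ι₃ hσ0 hΦ0 hψ0 hτ0
    (fun k => hubbardEffPartitionFnCT L M β U μ 0 K (klScale klE0 (d * k)) ≠ 0) hbase hι₁ hι₂ hι₃ hZ1 hZsucc hstep
    hx₁ hx₂ hx₃ hy hθ hu₁ hu₂ hclose

end Summit.HubbardSuperconductivity.HubbardSuperconductivity.Theorems.EngineV8

end
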